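import Mathlib
import Literature.Combinatorics.Enumerative.BoustrophedonTransform
import HarnessLib

/-!
# The double-ox transform (Millar–Sloane–Young 1996, Example 5 and Theorem 2)

Topic `Combinatorics/Enumerative`, namespace `Literature.Combinatorics.Enumerative.DoubleOx`.  Continues
`BoustrophedonTransform.lean` (`triangle`, `transform`, Theorem 1 (6) `transform_eq_sum`), `SnakesSpringerNumbers`'
companion `DerivativePolynomialGeneratingFunctions.lean` (`Q(1,t)(cos t − sin t) = 1`, `P(1,t)(cos t − sin t) =
sin t + cos t`, `Pₙ(1) = 2ⁿEₙ`) and `EulerZigzagGeneratingFunction.lean` (`cos·sec = 1`, `cos·tan = sin`).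
Definitions: `messenger a = m`, `output a = b`, and the first columns `colL a`, `colR a` of the two triangles;
everything else PROVED; no named fact, no `sorry`, no instance, no notation.

## Source, verbatim

J. Millar, N. J. A. Sloane, N. E. Young, JCTA 76 (1996) 44–54 [MillarSloaneYoung1996] (held arXiv:math/0205218),
§3, Example 5 and Theorem 2:

> «Example 5. The double-ox transform. Generalizing some examples of Arnold ([Arn92], see also [Dum95]), we
> consider two oxen plowing separate fields with a messenger that takes the output at the end of one row and
> rushes it to be used by the other ox as input to the next row. For example, if the initial sequence […] is
> 1,1,1,…, this produces the output sequence […] 1, 3, 9, 35, 177, 1123, … (A834). Less colorfully, let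
> a = a₀, a₁, … be the initial sequence, m = m₀, m₁, … the middle (or messenger) sequence, and b = b₀, b₁, … the
> transformed sequence. We define two triangles of numbers {L_{n,k}} and {R_{n,k}}, with 0 ≤ k ≤ n, by
> L_{2i,0} = a_{2i}, R_{2i+1,0} = a_{2i+1}, L_{2i,2i} = R_{2i,0} = m_{2i}, L_{2i+1,0} = R_{2i+1,2i+1} = m_{2i+1},
> L_{2i+1,2i+1} = b_{2i+1}, R_{2i,2i} = b_{2i}, and L_{n+1,k+1} = L_{n+1,k} + L_{n,n−k}, R_{n+1,k+1} = R_{n+1,k} +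
> R_{n,n−k}. We were happy to find that Theorem 1 leads to an equally simple description of this transformation.
> The proof is left to the reader.
> Theorem 2. The e.g.f.'s of a, m and b are related by 𝓜(x) = 𝓐(x)/(cos x − sin x),
> 𝓑(x) = (cos x + sin x)/(cos x − sin x) · 𝓐(x).»
> Acknowledgements: «A referee suggests that since the boustrophedon and double-ox transforms are associated with
> the root systems Aₙ and Cₙ, respectively (cf. [Arn92]), it would be worthwhile studying analogues of these
> transforms for other root systems.»

## What is formalized (the proof «left to the reader», supplied)

By Theorem 1 (6) applied to each triangle, the end of row `n` of the triangle with first column `c` is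
`Σₖ binom(n,k) cₖ E_{n−k}`.  The first column of `L` (resp. `R`) carries `a` at the even (resp. odd) indices and
the messenger at the others, so both oxen obey ONE recursion: `mₙ = Σₖ binom(n,k)E_{n−k}·(aₖ if k ≡ n, mₖ if
k ≢ n (mod 2))` and `bₙ = Σₖ binom(n,k)E_{n−k}·(mₖ if k ≡ n, aₖ if k ≢ n)`.  We DEFINE `messenger`/`output` by
these formulas (well-founded recursion) and PROVE that the triangles `triangle (colL a)`, `triangle (colR a)`
satisfy the eight defining equations of Example 5 (§1).  Splitting by the parity of `n − k` is convolution with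
the even part `sec` and the odd part `tan` of `sec + tan`, so `𝓜 = sec·𝓐 + tan·𝓜` and `𝓑 = sec·𝓜 + tan·𝓐`
(`messenger_egf_eq`, `output_egf_eq`); multiplying by `cos` gives ★★★ **Theorem 2**: `𝓜·(cos − sin) = 𝓐`
(`messenger_egf`) and `𝓑·(cos − sin) = (cos + sin)·𝓐` (`output_egf`, cancelling `cos` in the domain `ℚ⟦x⟧`).
Also: ★ Example 5's numbers `1, 3, 9, 35, 177, 1123` (with messenger `1, 2, 6, 24, 124, 792`) and its e.g.f.
`eˣ(cos + sin)/(cos − sin)`; ★★ the double-ox transform of `1, 0, 0, …` has messenger `Qₙ(1) = 1, 1, 3, 11, 57,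
361, …` — the Springer numbers of type `B`/`C` (the referee's remark) — and output `Pₙ(1) = 2ⁿEₙ`
(`messenger_delta_zero`, `output_delta_zero`), by comparison with Hoffman's `Q(1,t)`, `P(1,t)`; ring
homomorphisms commute with the transform (`map_messenger`, `map_output`).

MODEL NOTE.  `messenger`/`output` are sequences over any commutative semiring; the triangles are the tree's
`Boustrophedon.triangle` of the columns `colL`, `colR` (which mention `messenger`), and the identification of
their row ends with `m`, `b` is proved, not assumed.  NOT typed: Fig. 8, Arnold's/Dumont's further triangles.
-/

namespace Literature.Combinatorics.Enumerative
namespace DoubleOx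

open Finset Boustrophedon
open scoped Nat PowerSeries
open Literature.ComputerArithmetic.BrentZimmermann2010

section Semiring

variable {R : Type*} [CommSemiring R]

/-! ### §1 The two oxen and the messenger -/

/-- **The messenger sequence `m`** of the double-ox transform of `a`: `mₙ` is the number at the end of row `n`
of the triangle (`L` for even `n`, `R` for odd `n`) whose first column carries `a` at the indices of the parity of
`n` and the messenger values `m_k` (`k < n`) at the other indices — typed through Theorem 1 (6) as the explicit
recursion `mₙ = Σₖ binom(n,k) E_{n−k} · (aₖ if k ≡ n, mₖ if k ≢ n (mod 2))`; that the triangles `L`, `R` of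
Example 5 realise it is `transform_colL_even` / `transform_colR_odd` below.
[cite: MillarSloaneYoung1996, §3 Example 5 («L_{2i,2i} = R_{2i,0} = m_{2i}, L_{2i+1,0} = R_{2i+1,2i+1} = m_{2i+1}»)] -/
def messenger (a : ℕ → R) : ℕ → R
  | n => a n + ∑ k : Fin n, (n.choose k : R) * (eulerZigzag (n - k) : R) *
      (if (n + k) % 2 = 0 then a k else messenger a k)
  decreasing_by exact k.2

/-- **The output sequence `b`** of the double-ox transform: `bₙ` is the end of row `n` of the other triangle
(`R` for even `n`, `L` for odd `n`), i.e. `bₙ = Σₖ binom(n,k) E_{n−k} · (mₖ if k ≡ n, aₖ if k ≢ n (mod 2))`.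
[cite: MillarSloaneYoung1996, §3 Example 5 («L_{2i+1,2i+1} = b_{2i+1}, R_{2i,2i} = b_{2i}»)] -/
def output (a : ℕ → R) (n : ℕ) : R :=
  ∑ k ∈ range (n + 1), (n.choose k : R) * (eulerZigzag (n - k) : R) *
    (if (n + k) % 2 = 0 then messenger a k else a k)

/-- The messenger recursion with the sum over `0 ≤ k ≤ n` (the term `k = n` is `aₙ`).
[cite: MillarSloaneYoung1996, §3 Example 5 and §2 Theorem 1 eq. (6)] -/
theorem messenger_eq (a : ℕ → R) (n : ℕ) :
    messenger a n = ∑ k ∈ range (n + 1), (n.choose k : R) * (eulerZigzag (n - k) : R) *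
      (if (n + k) % 2 = 0 then a k else messenger a k) := by
  rw [messenger, Fin.sum_univ_eq_sum_range (fun k => (n.choose k : R) * (eulerZigzag (n - k) : R) *
      (if (n + k) % 2 = 0 then a k else messenger a k)) n, sum_range_succ, Nat.choose_self, Nat.sub_self,
    if_pos (by omega), add_comm]
  have hE0 : eulerZigzag 0 = 1 := by decide
  simp [hE0]

/-- The first column of the left triangle `L`: `a` at even indices, the messenger at odd indices
(«L_{2i,0} = a_{2i}», «L_{2i+1,0} = m_{2i+1}»). [cite: MillarSloaneYoung1996, §3 Example 5 («L_{2i,0} = a_{2i}, … L_{2i+1,0} = R_{2i+1,2i+1} = m_{2i+1}»)] -/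
def colL (a : ℕ → R) (k : ℕ) : R := if Even k then a k else messenger a k

/-- The first column of the right triangle `R`: the messenger at even indices, `a` at odd indices
(«R_{2i+1,0} = a_{2i+1}», «R_{2i,0} = m_{2i}»). [cite: MillarSloaneYoung1996, §3 Example 5 («R_{2i+1,0} = a_{2i+1}, L_{2i,2i} = R_{2i,0} = m_{2i}»)] -/
def colR (a : ℕ → R) (k : ℕ) : R := if Even k then messenger a k else a k

/-- `L_{2i,0} = a_{2i}`. [cite: MillarSloaneYoung1996, §3 Example 5 («L_{2i,0} = a_{2i}»)] -/
theorem triangleL_even_zero (a : ℕ → R) (i : ℕ) : triangle (colL a) (2 * i) 0 = a (2 * i) := by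
  rw [triangle_zero_right, colL, if_pos (even_two_mul i)]

/-- `R_{2i+1,0} = a_{2i+1}`. [cite: MillarSloaneYoung1996, §3 Example 5 («R_{2i+1,0} = a_{2i+1}»)] -/
theorem triangleR_odd_zero (a : ℕ → R) (i : ℕ) : triangle (colR a) (2 * i + 1) 0 = a (2 * i + 1) := by
  rw [triangle_zero_right, colR, if_neg (by simp)]

/-- `R_{2i,0} = m_{2i}`. [cite: MillarSloaneYoung1996, §3 Example 5 («R_{2i,0} = m_{2i}»)] -/
theorem triangleR_even_zero (a : ℕ → R) (i : ℕ) : triangle (colR a) (2 * i) 0 = messenger a (2 * i) := by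
  rw [triangle_zero_right, colR, if_pos (even_two_mul i)]

/-- `L_{2i+1,0} = m_{2i+1}`. [cite: MillarSloaneYoung1996, §3 Example 5 («L_{2i+1,0} = m_{2i+1}»)] -/
theorem triangleL_odd_zero (a : ℕ → R) (i : ℕ) :
    triangle (colL a) (2 * i + 1) 0 = messenger a (2 * i + 1) := by
  rw [triangle_zero_right, colL, if_neg (by simp)]

/-- Both triangles follow the boustrophedon rule. [cite: MillarSloaneYoung1996, §3 Example 5 («L_{n+1,k+1} = L_{n+1,k} + L_{n,n−k}, R_{n+1,k+1} = R_{n+1,k} + R_{n,n−k}»)] -/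
theorem triangleLR_succ_succ (a : ℕ → R) (n k : ℕ) :
    triangle (colL a) (n + 1) (k + 1) = triangle (colL a) (n + 1) k + triangle (colL a) n (n - k) ∧
      triangle (colR a) (n + 1) (k + 1) = triangle (colR a) (n + 1) k + triangle (colR a) n (n - k) :=
  ⟨triangle_succ_succ _ n k, triangle_succ_succ _ n k⟩

/-- `L_{2i,2i} = m_{2i}`: the left ox hands its even rows to the messenger.
[cite: MillarSloaneYoung1996, §3 Example 5 («L_{2i,2i} = R_{2i,0} = m_{2i}»)] -/
theorem transform_colL_even (a : ℕ → R) (i : ℕ) : transform (colL a) (2 * i) = messenger a (2 * i) := by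
  rw [transform_eq_sum, messenger_eq]
  refine sum_congr rfl fun k _ => ?_
  unfold colL
  rcases Nat.even_or_odd k with h | h
  · rw [if_pos h, if_pos (by obtain ⟨j, rfl⟩ := h; omega)]; ring
  · rw [if_neg (Nat.not_even_iff_odd.2 h), if_neg (by obtain ⟨j, rfl⟩ := h; omega)]; ring

/-- `R_{2i+1,2i+1} = m_{2i+1}`: the right ox hands its odd rows to the messenger.
[cite: MillarSloaneYoung1996, §3 Example 5 («L_{2i+1,0} = R_{2i+1,2i+1} = m_{2i+1}»)] -/
theorem transform_colR_odd (a : ℕ → R) (i : ℕ) :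
    transform (colR a) (2 * i + 1) = messenger a (2 * i + 1) := by
  rw [transform_eq_sum, messenger_eq]
  refine sum_congr rfl fun k _ => ?_
  unfold colR
  rcases Nat.even_or_odd k with h | h
  · rw [if_pos h, if_neg (by obtain ⟨j, rfl⟩ := h; omega)]; ring
  · rw [if_neg (Nat.not_even_iff_odd.2 h), if_pos (by obtain ⟨j, rfl⟩ := h; omega)]; ring

/-- `L_{2i+1,2i+1} = b_{2i+1}`. [cite: MillarSloaneYoung1996, §3 Example 5 («L_{2i+1,2i+1} = b_{2i+1}»)] -/
theorem transform_colL_odd (a : ℕ → R) (i : ℕ) : transform (colL a) (2 * i + 1) = output a (2 * i + 1) := by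
  rw [transform_eq_sum, output]
  refine sum_congr rfl fun k _ => ?_
  unfold colL
  rcases Nat.even_or_odd k with h | h
  · rw [if_pos h, if_neg (by obtain ⟨j, rfl⟩ := h; omega)]; ring
  · rw [if_neg (Nat.not_even_iff_odd.2 h), if_pos (by obtain ⟨j, rfl⟩ := h; omega)]; ring

/-- `R_{2i,2i} = b_{2i}`. [cite: MillarSloaneYoung1996, §3 Example 5 («R_{2i,2i} = b_{2i}»)] -/
theorem transform_colR_even (a : ℕ → R) (i : ℕ) : transform (colR a) (2 * i) = output a (2 * i) := by
  rw [transform_eq_sum, output]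
  refine sum_congr rfl fun k _ => ?_
  unfold colR
  rcases Nat.even_or_odd k with h | h
  · rw [if_pos h, if_pos (by obtain ⟨j, rfl⟩ := h; omega)]; ring
  · rw [if_neg (Nat.not_even_iff_odd.2 h), if_neg (by obtain ⟨j, rfl⟩ := h; omega)]; ring

/-- The messenger for the input `1, 1, 1, …` is `1, 2, 6, 24, 124, 792, …` (`= Σ binom(n,k) b_k` for the
Springer numbers `b_k`, by Theorem 2: e.g.f. `eˣ/(cos x − sin x)`).
[cite: MillarSloaneYoung1996, §3 Example 5 (Fig. 8, the messenger sequence) and Theorem 2] -/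
theorem messenger_one_seq :
    [messenger (fun _ => (1 : ℕ)) 0, messenger (fun _ => (1 : ℕ)) 1, messenger (fun _ => (1 : ℕ)) 2,
      messenger (fun _ => (1 : ℕ)) 3, messenger (fun _ => (1 : ℕ)) 4, messenger (fun _ => (1 : ℕ)) 5] =
      [1, 2, 6, 24, 124, 792] := by
  have m0 : messenger (fun _ => (1 : ℕ)) 0 = 1 := by rw [messenger_eq]; decide
  have m1 : messenger (fun _ => (1 : ℕ)) 1 = 2 := by
    rw [messenger_eq]; simp only [sum_range_succ, sum_range_zero, m0]; decide
  have m2 : messenger (fun _ => (1 : ℕ)) 2 = 6 := by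
    rw [messenger_eq]; simp only [sum_range_succ, sum_range_zero, m0, m1]; decide
  have m3 : messenger (fun _ => (1 : ℕ)) 3 = 24 := by
    rw [messenger_eq]; simp only [sum_range_succ, sum_range_zero, m0, m1, m2]; decide
  have m4 : messenger (fun _ => (1 : ℕ)) 4 = 124 := by
    rw [messenger_eq]; simp only [sum_range_succ, sum_range_zero, m0, m1, m2, m3]; decide
  have m5 : messenger (fun _ => (1 : ℕ)) 5 = 792 := by
    rw [messenger_eq]; simp only [sum_range_succ, sum_range_zero, m0, m1, m2, m3, m4]; decide
  rw [m0, m1, m2, m3, m4, m5]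

/-- ★ **Example 5**: for the input `1, 1, 1, …` the output is `1, 3, 9, 35, 177, 1123, …` (A000834).
[cite: MillarSloaneYoung1996, §3 Example 5 («if the initial sequence … is 1,1,1,…, this produces the output sequence … 1, 3, 9, 35, 177, 1123, …»)] -/
theorem output_one_seq :
    [output (fun _ => (1 : ℕ)) 0, output (fun _ => (1 : ℕ)) 1, output (fun _ => (1 : ℕ)) 2,
      output (fun _ => (1 : ℕ)) 3, output (fun _ => (1 : ℕ)) 4, output (fun _ => (1 : ℕ)) 5] =
      [1, 3, 9, 35, 177, 1123] := by
  obtain ⟨m0, m1, m2, m3, m4, m5⟩ : messenger (fun _ => (1 : ℕ)) 0 = 1 ∧ messenger (fun _ => (1 : ℕ)) 1 = 2 ∧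
      messenger (fun _ => (1 : ℕ)) 2 = 6 ∧ messenger (fun _ => (1 : ℕ)) 3 = 24 ∧
      messenger (fun _ => (1 : ℕ)) 4 = 124 ∧ messenger (fun _ => (1 : ℕ)) 5 = 792 := by
    simpa using messenger_one_seq
  simp only [output, sum_range_succ, sum_range_zero, m0, m1, m2, m3, m4, m5]
  decide

/-- Ring homomorphisms commute with the messenger … [cite: MillarSloaneYoung1996, §2 footnote («the transformation can be applied to sequences over any ring»)] -/
theorem map_messenger {S : Type*} [CommSemiring S] (f : R →+* S) (a : ℕ → R) :
    ∀ n, f (messenger a n) = messenger (fun k => f (a k)) n := by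
  intro n
  induction n using Nat.strong_induction_on with
  | _ n ih =>
    rw [messenger_eq, messenger_eq, map_sum]
    refine sum_congr rfl fun k hk => ?_
    rw [map_mul, map_mul, map_natCast, map_natCast]
    congr 1
    split_ifs with h
    · rfl
    · have hkn : k < n := by
        rcases Nat.lt_or_ge k n with h' | h'
        · exact h'
        · exfalso
          have : k = n := le_antisymm (Nat.lt_succ_iff.1 (mem_range.1 hk)) h'
          subst this; omega
      exact ih k hkn

/-- … and with the output. [cite: MillarSloaneYoung1996, §2 footnote («the transformation can be applied to sequences over any ring»)] -/
theorem map_output {S : Type*} [CommSemiring S] (f : R →+* S) (a : ℕ → R) (n : ℕ) :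
    f (output a n) = output (fun k => f (a k)) n := by
  rw [output, output, map_sum]
  refine sum_congr rfl fun k _ => ?_
  rw [map_mul, map_mul, map_natCast, map_natCast]
  congr 1
  split_ifs
  · exact map_messenger f a k
  · rfl

end Semiring

/-! ### §2 Theorem 2: the exponential generating functions -/

section EGF

/-- `sec x` as the exponential generating function of `Eₙ·[n even]`. [cite: MillarSloaneYoung1996, §1 eq. (3) («𝓔(x) = sec x + tan x»)] -/
theorem secSeries_eq_mk :
    secSeries = PowerSeries.mk fun j => (if Even j then (eulerZigzag j : ℚ) else 0) / (j ! : ℚ) := by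
  ext j
  rw [coeff_secSeries, PowerSeries.coeff_mk]
  split_ifs <;> simp

/-- `tan x` as the exponential generating function of `Eₙ·[n odd]`. [cite: MillarSloaneYoung1996, §1 eq. (3) («𝓔(x) = sec x + tan x»)] -/
theorem tanSeries_eq_mk :
    tanSeries = PowerSeries.mk fun j => (if Even j then 0 else (eulerZigzag j : ℚ)) / (j ! : ℚ) := by
  ext j
  rw [coeff_tanSeries, PowerSeries.coeff_mk]
  split_ifs <;> simp

/-- Re-indexing `k ↦ n − k` of the parity-split convolution: the terms with `k ≡ n` are a convolution with
`sec`, those with `k ≢ n` a convolution with `tan`. [cite: MillarSloaneYoung1996, §3 Theorem 2 (proof «left to the reader»)] -/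
theorem sum_parity_split (n : ℕ) (x y : ℕ → ℚ) :
    ∑ k ∈ range (n + 1), (n.choose k : ℚ) * (eulerZigzag (n - k) : ℚ) * (if (n + k) % 2 = 0 then x k else y k) =
      (∑ j ∈ range (n + 1), (n.choose j : ℚ) * (if Even j then (eulerZigzag j : ℚ) else 0) * x (n - j)) +
        ∑ j ∈ range (n + 1), (n.choose j : ℚ) * (if Even j then 0 else (eulerZigzag j : ℚ)) * y (n - j) := by
  rw [← sum_add_distrib, ← sum_range_reflect]
  refine sum_congr rfl fun j hj => ?_
  have hjn : j ≤ n := Nat.lt_succ_iff.1 (mem_range.1 hj)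
  rw [show n + 1 - 1 - j = n - j by omega, Nat.choose_symm hjn, show n - (n - j) = j by omega]
  by_cases h : Even j
  · rw [if_pos (by obtain ⟨i, rfl⟩ := h; omega), if_pos h, if_pos h]; ring
  · rw [if_neg (by rw [Nat.even_iff] at h; omega), if_neg h, if_neg h]; ring

/-- `𝓜 = sec·𝓐 + tan·𝓜`: the messenger recursion at the level of e.g.f.'s.
[cite: MillarSloaneYoung1996, §3 Theorem 2 («𝓜(x) = 𝓐(x)/(cos x − sin x)»)] -/
theorem messenger_egf_eq (a : ℕ → ℚ) :
    (PowerSeries.mk fun n => messenger a n / (n ! : ℚ)) =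
      secSeries * (PowerSeries.mk fun n => a n / (n ! : ℚ)) +
        tanSeries * PowerSeries.mk fun n => messenger a n / (n ! : ℚ) := by
  ext n
  rw [PowerSeries.coeff_mk, map_add, secSeries_eq_mk, tanSeries_eq_mk, DerivativePolynomials.coeff_egf_mul,
    DerivativePolynomials.coeff_egf_mul, ← add_div, messenger_eq, sum_parity_split]

/-- `𝓑 = sec·𝓜 + tan·𝓐`: the output at the level of e.g.f.'s.
[cite: MillarSloaneYoung1996, §3 Theorem 2 («𝓑(x) = (cos x + sin x)/(cos x − sin x) 𝓐(x)»)] -/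
theorem output_egf_eq (a : ℕ → ℚ) :
    (PowerSeries.mk fun n => output a n / (n ! : ℚ)) =
      secSeries * (PowerSeries.mk fun n => messenger a n / (n ! : ℚ)) +
        tanSeries * PowerSeries.mk fun n => a n / (n ! : ℚ) := by
  ext n
  rw [PowerSeries.coeff_mk, map_add, secSeries_eq_mk, tanSeries_eq_mk, DerivativePolynomials.coeff_egf_mul,
    DerivativePolynomials.coeff_egf_mul, ← add_div, output, sum_parity_split]

/-- ★★★ **Theorem 2, the messenger**: `𝓜(x)·(cos x − sin x) = 𝓐(x)`, i.e. `𝓜 = 𝓐/(cos x − sin x)`.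
[cite: MillarSloaneYoung1996, §3 Theorem 2 («𝓜(x) = 1/(cos x − sin x) · 𝓐(x)»)] -/
theorem messenger_egf (a : ℕ → ℚ) :
    (PowerSeries.mk fun n => messenger a n / (n ! : ℚ)) * (PowerSeries.cos ℚ - PowerSeries.sin ℚ) =
      PowerSeries.mk fun n => a n / (n ! : ℚ) := by
  have h := messenger_egf_eq a
  linear_combination (PowerSeries.cos ℚ) * h +
    (PowerSeries.mk fun n => a n / (n ! : ℚ)) * cos_mul_secSeries +
    (PowerSeries.mk fun n => messenger a n / (n ! : ℚ)) * cos_mul_tanSeries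

/-- ★★★ **Theorem 2, the output**: `𝓑(x)·(cos x − sin x) = (cos x + sin x)·𝓐(x)`.
[cite: MillarSloaneYoung1996, §3 Theorem 2 («𝓑(x) = (cos x + sin x)/(cos x − sin x) · 𝓐(x)»)] -/
theorem output_egf (a : ℕ → ℚ) :
    (PowerSeries.mk fun n => output a n / (n ! : ℚ)) * (PowerSeries.cos ℚ - PowerSeries.sin ℚ) =
      (PowerSeries.cos ℚ + PowerSeries.sin ℚ) * PowerSeries.mk fun n => a n / (n ! : ℚ) := by
  set A := PowerSeries.mk fun n => a n / (n ! : ℚ) with hA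
  set M := PowerSeries.mk fun n => messenger a n / (n ! : ℚ) with hM
  set B := PowerSeries.mk fun n => output a n / (n ! : ℚ) with hB
  have h' : B = secSeries * M + tanSeries * A := output_egf_eq a
  have hm : M * (PowerSeries.cos ℚ - PowerSeries.sin ℚ) = A := messenger_egf a
  have key : PowerSeries.cos ℚ * (B * (PowerSeries.cos ℚ - PowerSeries.sin ℚ)) =
      PowerSeries.cos ℚ * ((PowerSeries.cos ℚ + PowerSeries.sin ℚ) * A) := by
    linear_combination (PowerSeries.cos ℚ * (PowerSeries.cos ℚ - PowerSeries.sin ℚ)) * h' +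
      ((PowerSeries.cos ℚ - PowerSeries.sin ℚ) * M) * cos_mul_secSeries +
      ((PowerSeries.cos ℚ - PowerSeries.sin ℚ) * A) * cos_mul_tanSeries + hm - A * sin_sq_add_cos_sq
  exact mul_left_cancel₀ cos_ne_zero key

/-- Example 5 at the level of e.g.f.'s: for the input `1, 1, 1, …` the output has e.g.f.
`eˣ(cos x + sin x)/(cos x − sin x)`. [cite: MillarSloaneYoung1996, §3 Example 5 and Theorem 2] -/
theorem output_one_seq_egf :
    (PowerSeries.mk fun n => output (fun _ => (1 : ℚ)) n / (n ! : ℚ)) *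
        (PowerSeries.cos ℚ - PowerSeries.sin ℚ) =
      (PowerSeries.cos ℚ + PowerSeries.sin ℚ) * PowerSeries.exp ℚ := by
  have h2 : (PowerSeries.mk fun n => (1 : ℚ) / (n ! : ℚ)) = PowerSeries.exp ℚ := by
    ext n; simp [PowerSeries.coeff_exp]
  rw [output_egf, h2]

/-! ### §3 The double-ox transform of `1, 0, 0, …`: Springer numbers -/

/-- `𝓐 = 1` for the input `1, 0, 0, …`. [cite: MillarSloaneYoung1996, §3 Theorem 2] -/
theorem egf_delta_zero :
    (PowerSeries.mk fun n => (if n = 0 then (1 : ℚ) else 0) / (n ! : ℚ)) = 1 := by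
  ext n
  rw [PowerSeries.coeff_mk, PowerSeries.coeff_one]
  split_ifs with h <;> simp [h]

/-- ★★ **The messenger of `1, 0, 0, …` is the sequence of Springer numbers `bₙ = Qₙ(1)`** (`1, 1, 3, 11, 57, 361, …`,
e.g.f. `1/(cos x − sin x)`; «the double-ox transform [is] associated with the root system Cₙ»).
[cite: MillarSloaneYoung1996, §3 Theorem 2 («𝓜(x) = 𝓐(x)/(cos x − sin x)») and Acknowledgements («the boustrophedon and double-ox transforms are associated with the root systems Aₙ and Cₙ, respectively (cf. [Arn92])»); Hoffman1999DerivativePolynomials, §4 Proposition 4.1 («Q(1,t) = 1/(cos t − sin t)»)] -/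
theorem messenger_delta_zero (n : ℕ) :
    messenger (fun i => if i = 0 then (1 : ℕ) else 0) n = (TangentNumbers.Q n).eval 1 := by
  have hM := messenger_egf (fun i => if i = 0 then (1 : ℚ) else 0)
  rw [egf_delta_zero, ← DerivativePolynomials.egfQ_one_mul] at hM
  have hne : PowerSeries.cos ℚ - PowerSeries.sin ℚ ≠ 0 := fun h => by
    have := congrArg PowerSeries.constantCoeff h
    rw [map_sub, constantCoeff_cos, constantCoeff_sin, map_zero] at this
    norm_num at this
  have hc := PowerSeries.ext_iff.1 (mul_right_cancel₀ hne hM) n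
  rw [PowerSeries.coeff_mk, DerivativePolynomials.coeff_egfQ, DerivativePolynomials.aeval_one_nat,
    div_left_inj' (by positivity)] at hc
  have hcast : ((messenger (fun i => if i = 0 then (1 : ℕ) else 0) n : ℕ) : ℚ) =
      messenger (fun i => if i = 0 then (1 : ℚ) else 0) n := by
    have h := map_messenger (Nat.castRingHom ℚ) (fun i => if i = 0 then (1 : ℕ) else 0) n
    simp only [Nat.coe_castRingHom, Nat.cast_ite, Nat.cast_one, Nat.cast_zero] at h
    exact h
  exact_mod_cast hcast.trans hc

/-- ★★ **The output of `1, 0, 0, …` is `Pₙ(1) = 2ⁿEₙ`** (`1, 2, 4, 16, 80, …`, e.g.f. `(cos x + sin x)/(cos x − sin x)`).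
[cite: MillarSloaneYoung1996, §3 Theorem 2 («𝓑(x) = (cos x + sin x)/(cos x − sin x) 𝓐(x)»); Hoffman1999DerivativePolynomials, §3 eq. (5) and §4 («P(1,t) = (sin t + cos t)/(cos t − sin t)»)] -/
theorem output_delta_zero (n : ℕ) :
    output (fun i => if i = 0 then (1 : ℕ) else 0) n = 2 ^ n * eulerZigzag n := by
  have hB := output_egf (fun i => if i = 0 then (1 : ℚ) else 0)
  rw [egf_delta_zero, mul_one, add_comm, ← DerivativePolynomials.egfP_one_mul] at hB
  have hne : PowerSeries.cos ℚ - PowerSeries.sin ℚ ≠ 0 := fun h => by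
    have := congrArg PowerSeries.constantCoeff h
    rw [map_sub, constantCoeff_cos, constantCoeff_sin, map_zero] at this
    norm_num at this
  have hc := PowerSeries.ext_iff.1 (mul_right_cancel₀ hne hB) n
  rw [PowerSeries.coeff_mk, DerivativePolynomials.coeff_egfP, DerivativePolynomials.aeval_one_nat,
    DerivativePolynomials.eval_one_P, div_left_inj' (by positivity)] at hc
  have hcast : ((output (fun i => if i = 0 then (1 : ℕ) else 0) n : ℕ) : ℚ) =
      output (fun i => if i = 0 then (1 : ℚ) else 0) n := by
    have h := map_output (Nat.castRingHom ℚ) (fun i => if i = 0 then (1 : ℕ) else 0) n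
    simp only [Nat.coe_castRingHom, Nat.cast_ite, Nat.cast_one, Nat.cast_zero] at h
    exact h
  exact_mod_cast hcast.trans hc

/-- The first values for the input `1, 0, 0, …`: messenger `1, 1, 3, 11, 57, 361` (Springer numbers) and output
`1, 2, 4, 16, 80, 512`. [cite: MillarSloaneYoung1996, §3 Theorem 2; Hoffman1999DerivativePolynomials, §4 Proposition 4.1] -/
theorem doubleOx_delta_zero_values :
    (List.range 6).map (messenger fun i => if i = 0 then (1 : ℕ) else 0) = [1, 1, 3, 11, 57, 361] ∧
      (List.range 6).map (output fun i => if i = 0 then (1 : ℕ) else 0) = [1, 2, 4, 16, 80, 512] := by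
  have e : [eulerZigzag 0, eulerZigzag 1, eulerZigzag 2, eulerZigzag 3, eulerZigzag 4, eulerZigzag 5] =
      [1, 1, 1, 2, 5, 16] := eulerZigzag_values
  simp only [List.cons.injEq, and_true] at e
  obtain ⟨e0, e1, e2, e3, e4, e5⟩ := e
  simp [List.range, List.range.loop, messenger_delta_zero, output_delta_zero,
    DerivativePolynomials.eval_one_Q_eq_sum, sum_range_succ, TangentNumbers.q_succ, e0, e1, e2, e3, e4, e5]

end EGF

end DoubleOx
end Literature.Combinatorics.Enumerative
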